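import Literature.RepresentationTheory.HarrisKudlaSweet1996.GlobalSplittingCharacters
import Literature.NumberTheory.Automorphic.QuadraticHeckeCharacterQuadExt
import Literature.NumberTheory.GaloisRepresentations.HeckeCharacterExtensionQuadraticGeneralProofs
import HarnessLib

/-!
# The global splitting-character condition `χ|_{𝕀_F} = ε^m_{E/F}` for an ARBITRARY quadratic extension `E/F`

Topic `RepresentationTheory/HarrisKudlaSweet1996`; namespace `Literature.RepresentationTheory.HarrisKudlaSweet1996`.
One definition (a `Prop`) and its API; everything is proved, no named fact, no instance.

Source: M. Harris, S. Kudla, W. Sweet, *Theta dichotomy for unitary groups*, JAMS 9 (1996) [HarrisKudlaSweet1996],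
§0 (0.9) p. 944 and §1 (1.5) p. 951: for a quadratic extension `E/F` of number fields with quadratic character
`ε_{E/F}` of `𝔸_F^×/F^×`, "we choose a character `χ = χ_V` of `𝔸_E^×/E^×` such that `χ_V|_{𝔸_F^×} = ε^m_{E/F}`"
(`m = dim_E V`) — the character datum of Kudla's splitting `U(V)(𝔸) → Mp(𝕎)` [Kudla1994, §3]; the same datum
is "`γ` a unitary character of `I_E/E^*` whose restriction to `I_F` is `ω_{E/F}`" in [GelbartRogawski1991, §3.1
p. 456, (3.1.2)].  The printed generality is EVERY quadratic extension `E/F`; the tree's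
`GlobalSplittingCharacters.lean` (`IsSplittingChar L m χ`) typed it for a CM field `L` over `L⁺` only.

THIS FILE types the condition at the printed generality, using ONLY tree objects:
* `ε_{E/F} = Automorphic.quadraticHeckeCharExt F E : HeckeCharacter F` (`QuadraticHeckeCharacterQuadExt.lean`:
  the intrinsic quadratic Hecke character of `E/F`, O'Meara 65:21);
* the base change of idèles `𝕀_F → 𝕀_E`, `Automorphic.AdeleRing.ideleBaseChange F E`;
* Hecke characters `GaloisRepresentations.HeckeCharacter E`, `HeckeCharacter.IsUnitary`.

WHAT IS DEFINED / PROVED (kernel, no cited fact):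
* `IsSplittingCharExt F E m χ : Prop` — `χ (x_E) = ε_{E/F}(x)^m` for every idèle `x` of `F`;
  `isSplittingCharExt_iff_admissible` (it IS the printed (1.5) record `Partner.Admissible` of `Splittings.lean` for
  `toE := ideleBaseChange F E`, `ε := ε_{E/F}`); `isSplittingCharExt_iff_mod_two` (only the parity of `m` matters),
  `IsSplittingCharExt.mul/.inv/.pow`, `isSplittingCharExt_one` (`χ = 1` for even `m`);
* **`exists_isUnitary_isSplittingCharExt_one`** — FOR EVERY QUADRATIC EXTENSION `E/F` OF NUMBER FIELDS a unitary
  Hecke character `χ` of `E` with `χ|_{𝕀_F} = ε_{E/F}` EXISTS: the tree's kernel theorem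
  `GaloisRepresentations.HeckeCharacter.HewittRoss_heckeCharacter_extension_quadratic_holds'` (extension of unitary
  idèle class characters along a quadratic extension — Weil's extension principle + Dirichlet's unit theorem,
  `HeckeCharacterExtensionQuadraticGeneralProofs.lean`) applied to the unitary character `ε_{E/F}`; hence
  `exists_isUnitary_isSplittingCharExt` for every `m`;
* **the CM field case** — `isSplittingChar_iff_isSplittingCharExt`: for a CM field `L`,
  `IsSplittingChar L m χ ↔ IsSplittingCharExt L⁺ L m χ` (`quadraticHeckeCharCM_eq_quadraticHeckeCharExt`).

Written for the general-`(F, E, σ)` programme of the kernel proof of [GelbartRogawski1991, Prop. 3.1.1]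
(`Prop311AsPrinted`).  Nothing in this file is a claim of the manuscripts adjudicated by the Hodge-CM cell.

## References

* [HarrisKudlaSweet1996] M. Harris, S. Kudla, W. Sweet, JAMS 9 (1996), (0.9) p. 944, §1 (1.5) p. 951.
* [GelbartRogawski1991] S. Gelbart, J. Rogawski, Invent. Math. 105 (1991), §3.1 p. 456 (3.1.2).
* [Kudla1994] S. Kudla, Israel J. Math. 87 (1994), §3.
* [Weil1956] A. Weil, *On a certain type of characters of the idèle-class group…* (1956), §1 (the extension method).
-/

set_option autoImplicit false

noncomputable section

open scoped NumberField
open NumberField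

namespace Literature.RepresentationTheory.HarrisKudlaSweet1996

open _root_.Literature.NumberTheory.GaloisRepresentations
open _root_.Literature.NumberTheory.Automorphic
open _root_.Literature.NumberTheory.QuadraticForms.QuadraticExtension

section General

variable (F E : Type) [Field F] [NumberField F] [Field E] [NumberField E] [Algebra F E]
  [Algebra.IsQuadraticExtension F E]

/-! ## 1. The splitting condition (1.5) for an arbitrary quadratic extension -/

/-- **The splitting condition [HarrisKudlaSweet1996, (1.5) p. 951] for a Hecke character `χ` of `E`, `E/F` ANY
quadratic extension of number fields:** `χ|_{𝕀_F} = ε_{E/F}^m`, i.e. `χ(x_E) = ε_{E/F}(x)^m` for every idèle `x`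
of `F` (`x_E` its base change to `𝕀_E`, `ε_{E/F} = quadraticHeckeCharExt F E`).  For `m = dim V` this is the
condition on `χ_V`. [cite: HarrisKudlaSweet1996, (1.5) p. 951] -/
def IsSplittingCharExt (m : ℕ) (χ : HeckeCharacter E) : Prop :=
  ∀ x : ideleGroup F, χ (AdeleRing.ideleBaseChange F E x) = quadraticHeckeCharExt F E x ^ m

variable {F E}

/-- `IsSplittingCharExt` IS the tree's printed record `Partner.Admissible` [(1.5) p. 951] instantiated with the
idèle groups `Eu := 𝕀_E`, `Fu := 𝕀_F`, the base change `toE := ideleBaseChange F E`, `ε := ε_{E/F}` (for any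
value of the unused field `det`). [cite: HarrisKudlaSweet1996, (1.5) p. 951] -/
theorem isSplittingCharExt_iff_admissible (m : ℕ) (χ : HeckeCharacter E) (d : ideleGroup F) :
    IsSplittingCharExt F E m χ ↔
      (Partner.mk m d (χ : ideleGroup E →* ℂˣ)).Admissible (AdeleRing.ideleBaseChange F E)
        (quadraticHeckeCharExt F E : ideleGroup F →* ℂˣ) :=
  Iff.rfl

omit [NumberField E] in
/-- `ε(x)^m` depends only on `m mod 2` (`ε(x)² = 1`). [cite: HarrisKudlaSweet1996, (1.5) p. 951] -/
theorem quadraticHeckeCharExt_pow_eq_pow_mod_two (x : ideleGroup F) (m : ℕ) :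
    quadraticHeckeCharExt F E x ^ m = quadraticHeckeCharExt F E x ^ (m % 2) := by
  conv_lhs => rw [← Nat.mod_add_div m 2, pow_add, pow_mul, quadraticHeckeCharExt_apply_sq, one_pow, mul_one]

/-- only the PARITY of `m` matters in (1.5). [cite: HarrisKudlaSweet1996, (1.5) p. 951] -/
theorem isSplittingCharExt_iff_mod_two (m : ℕ) (χ : HeckeCharacter E) :
    IsSplittingCharExt F E m χ ↔ IsSplittingCharExt F E (m % 2) χ :=
  forall_congr' fun x => by rw [quadraticHeckeCharExt_pow_eq_pow_mod_two]

/-- for EVEN `m` the condition is `χ|_{𝕀_F} = 1`. [cite: HarrisKudlaSweet1996, (1.5) p. 951] -/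
theorem isSplittingCharExt_iff_of_even {m : ℕ} (hm : Even m) (χ : HeckeCharacter E) :
    IsSplittingCharExt F E m χ ↔ ∀ x : ideleGroup F, χ (AdeleRing.ideleBaseChange F E x) = 1 :=
  forall_congr' fun x => by
    rw [quadraticHeckeCharExt_pow_eq_pow_mod_two, Nat.even_iff.mp hm, pow_zero]

/-- for ODD `m` the condition is `χ|_{𝕀_F} = ε_{E/F}`. [cite: HarrisKudlaSweet1996, (1.5) p. 951] -/
theorem isSplittingCharExt_iff_of_odd {m : ℕ} (hm : Odd m) (χ : HeckeCharacter E) :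
    IsSplittingCharExt F E m χ ↔
      ∀ x : ideleGroup F, χ (AdeleRing.ideleBaseChange F E x) = quadraticHeckeCharExt F E x :=
  forall_congr' fun x => by
    rw [quadraticHeckeCharExt_pow_eq_pow_mod_two, Nat.odd_iff.mp hm, pow_one]

/-- the trivial character satisfies (1.5) for even `m`. [cite: HarrisKudlaSweet1996, (1.5) p. 951] -/
theorem isSplittingCharExt_one {m : ℕ} (hm : Even m) : IsSplittingCharExt F E m 1 :=
  (isSplittingCharExt_iff_of_even hm 1).mpr fun _ => rfl

/-- (1.5) is multiplicative: `χ₁| = ε^{m₁}`, `χ₂| = ε^{m₂}` ⇒ `(χ₁χ₂)| = ε^{m₁+m₂}` (the character of an orthogonal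
sum `V₁ ⊕ V₂`, cf. `Partner.Admissible.sum`). [cite: HarrisKudlaSweet1996, (1.5) p. 951] -/
theorem IsSplittingCharExt.mul {m₁ m₂ : ℕ} {χ₁ χ₂ : HeckeCharacter E} (h₁ : IsSplittingCharExt F E m₁ χ₁)
    (h₂ : IsSplittingCharExt F E m₂ χ₂) : IsSplittingCharExt F E (m₁ + m₂) (χ₁ * χ₂) := fun x => by
  rw [HeckeCharacter.mul_apply, h₁ x, h₂ x, pow_add]

/-- (1.5) is stable under inversion (`ε^m` is its own inverse). [cite: HarrisKudlaSweet1996, (1.5) p. 951] -/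
theorem IsSplittingCharExt.inv {m : ℕ} {χ : HeckeCharacter E} (h : IsSplittingCharExt F E m χ) :
    IsSplittingCharExt F E m χ⁻¹ := fun x => by
  rw [HeckeCharacter.inv_apply, h x, inv_eq_iff_mul_eq_one, ← pow_add, ← two_mul, pow_mul,
    quadraticHeckeCharExt_apply_sq, one_pow]

/-- powers: `χ| = ε^m` ⇒ `χ^k| = ε^{mk}`. [cite: HarrisKudlaSweet1996, (1.5) p. 951] -/
theorem IsSplittingCharExt.pow {m : ℕ} {χ : HeckeCharacter E} (h : IsSplittingCharExt F E m χ) (k : ℕ) :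
    IsSplittingCharExt F E (m * k) (χ ^ k) := fun x => by
  rw [HeckeCharacter.pow_apply, h x, pow_mul]

/-! ## 2. Existence (kernel): a unitary Hecke character of `E` extending `ε_{E/F}`, for EVERY quadratic `E/F` -/

variable (F E) in
/-- **A unitary Hecke character `χ` of `E` with `χ|_{𝕀_F} = ε_{E/F}` EXISTS, for every quadratic extension `E/F`
of number fields** ([GelbartRogawski1991, §3.1 p. 456]: "let `γ` be a unitary character of `I_E/E^*` whose
restriction to `I_F` is `ω_{E/F}`") — the tree's kernel theorem
`HeckeCharacter.HewittRoss_heckeCharacter_extension_quadratic_holds'` (extension of unitary idèle class characters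
along the quadratic extension `E/F` with its non-trivial automorphism, no places to keep unramified) applied to the
unitary character `χ₀ = ε_{E/F}`. [cite: GelbartRogawski1991, §3.1 p. 456 (3.1.2); HarrisKudlaSweet1996, (1.5) p. 951] -/
theorem exists_isUnitary_isSplittingCharExt_one :
    ∃ χ : HeckeCharacter E, χ.IsUnitary ∧ IsSplittingCharExt F E 1 χ := by
  haveI : CharZero F := inferInstance
  obtain ⟨σ, hσ⟩ := exists_algEquiv_ne_one (K := F) (E := E)
  obtain ⟨χ, hu, hres, -⟩ :=
    HeckeCharacter.HewittRoss_heckeCharacter_extension_quadratic_holds' F E σ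
      (Algebra.IsQuadraticExtension.finrank_eq_two F E) hσ (quadraticHeckeCharExt F E)
      (isUnitary_quadraticHeckeCharExt F E) ∅ (fun _ h => h.elim)
  exact ⟨χ, hu, fun x => (hres x).trans (pow_one _).symm⟩

variable (F E) in
/-- **for every `m`, a unitary Hecke character of `E` with `χ|_{𝕀_F} = ε^m_{E/F}` exists** (`χ^m` for the `χ` of
`exists_isUnitary_isSplittingCharExt_one`). [cite: HarrisKudlaSweet1996, (1.5) p. 951] -/
theorem exists_isUnitary_isSplittingCharExt (m : ℕ) :
    ∃ χ : HeckeCharacter E, χ.IsUnitary ∧ IsSplittingCharExt F E m χ := by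
  obtain ⟨χ, hu, h⟩ := exists_isUnitary_isSplittingCharExt_one F E
  refine ⟨χ ^ m, fun x => ?_, by simpa using h.pow m⟩
  rw [HeckeCharacter.pow_apply, Units.val_pow_eq_pow_val, norm_pow, hu x, one_pow]

end General

/-! ## 3. The CM field case -/

section CM

variable (L : Type) [Field L] [NumberField L] [IsCMField L]

/-- **For a CM field `L`, the CM condition `IsSplittingChar L m χ` (`χ|_{𝕀_{L⁺}} = ε_{L/L⁺}^m`) IS the general one
at `(F, E) := (L⁺, L)`** (`quadraticHeckeCharCM L = quadraticHeckeCharExt L⁺ L`). [cite: HarrisKudlaSweet1996, (1.5) p. 951] -/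
theorem isSplittingChar_iff_isSplittingCharExt (m : ℕ) (χ : HeckeCharacter L) :
    IsSplittingChar L m χ ↔ IsSplittingCharExt (maximalRealSubfield L) L m χ :=
  forall_congr' fun x => by rw [quadraticHeckeCharCM_eq_quadraticHeckeCharExt]

end CM

end Literature.RepresentationTheory.HarrisKudlaSweet1996

end
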